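import Mathlib
import Summits.ValiantsHypothesis.ValiantsHypothesis.Theorems.RigidityForcesSymmetryRankRigidMinimalReprLaplaceFiveStarRestrictionRank

/-!
# ValiantsHypothesis / RigidityForcesSymmetry — crux `LaplaceOptimalFive` (stmt-ValiantsHypothesis-24813), crux idea
`young-shadow` (K1) on the star: **THE PATTERN `P₅` IN LETTER AND POLYNOMIAL CURRENCY** (wiring)
(memo `NOTE-p4g15-24813-K1-star.md` §1 «for `m = y₀y₁y₂y₃y₄`, `𝒰(Hess m)` = the 10 off-diagonal elementary symmetric
matrices»; memo `NOTE-p4g16-24813-LemmaK-kernel.md` r2 §4 (iv))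

* `word_injective_iff` — for distinct slots `p,a,b,c,d` the word `p ↦ A, a ↦ B, b ↦ C, c ↦ D, d ↦ E` is injective iff the
  letters `A,…,E` are pairwise distinct (this is the value `P₅(A,B,C,D,E)` delivered by ✓ `star_letter_reading`).
* ★ `pattern_cubic` — for `A ≠ B`: `Σ_{C,D,E} [A,B,C,D,E pairwise distinct]·X_CX_DX_E = 6·x^{{A,B}ᶜ}` (the squarefree monomial
  `monomial 𝟙_{{A,B}ᶜ} 1` of ✓ `offDiag_relations_fine`), and `= 0` for `A = B` (`pattern_cubic_diag`).

No definitions, no `sorry`.  Honest framing: wiring brick, closes nothing; K1-on-the-star PAPER PASS, not kernel;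
`LaplaceOptimalFive` OPEN · CONTESTED 72/120; `VP ≠ VNP` NOT proved.
-/

set_option linter.dupNamespace false

namespace Summit.ValiantsHypothesis.ValiantsHypothesis.Theorems.RigidityForcesSymmetryRankRigidMinimalRepr

namespace LaplaceFiveStar

open Finset MvPolynomial

/-- **Injective word ↔ pairwise distinct letters.** [folklore] -/
theorem word_injective_iff (p a b c d : Fin 5) (hpa : p ≠ a) (hpb : p ≠ b) (hpc : p ≠ c) (hpd : p ≠ d) (hab : a ≠ b)
    (hac : a ≠ c) (had : a ≠ d) (hbc : b ≠ c) (hbd : b ≠ d) (hcd : c ≠ d)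
    (hcover : ∀ i : Fin 5, i = p ∨ i = a ∨ i = b ∨ i = c ∨ i = d) (A B C D E : Fin 5) :
    Function.Injective (fun i : Fin 5 => if i = p then A else if i = a then B else if i = b then C else if i = c then D else E)
      ↔ (A ≠ B ∧ A ≠ C ∧ A ≠ D ∧ A ≠ E ∧ B ≠ C ∧ B ≠ D ∧ B ≠ E ∧ C ≠ D ∧ C ≠ E ∧ D ≠ E) := by
  set ω : Fin 5 → Fin 5 := fun i => if i = p then A else if i = a then B else if i = b then C else if i = c then D else E
    with hω
  have wp : ω p = A := by simp [hω]
  have wa : ω a = B := by simp [hω, hpa.symm]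
  have wb : ω b = C := by simp [hω, hpb.symm, hab.symm]
  have wc : ω c = D := by simp [hω, hpc.symm, hac.symm, hbc.symm]
  have wd : ω d = E := by simp [hω, hpd.symm, had.symm, hbd.symm, hcd.symm]
  constructor
  · intro h
    refine ⟨fun e => hpa (h ?_), fun e => hpb (h ?_), fun e => hpc (h ?_), fun e => hpd (h ?_), fun e => hab (h ?_),
      fun e => hac (h ?_), fun e => had (h ?_), fun e => hbc (h ?_),
      fun e => hbd (h ?_), fun e => hcd (h ?_)⟩
    all_goals first
      | (rw [wp, wa]; exact e) | (rw [wp, wb]; exact e) | (rw [wp, wc]; exact e) | (rw [wp, wd]; exact e)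
      | (rw [wa, wb]; exact e) | (rw [wa, wc]; exact e) | (rw [wa, wd]; exact e) | (rw [wb, wc]; exact e)
      | (rw [wb, wd]; exact e) | (rw [wc, wd]; exact e)
  · rintro ⟨hAB, hAC, hAD, hAE, hBC, hBD, hBE, hCD, hCE, hDE⟩ i j hij
    have hij' : ω i = ω j := hij
    rcases hcover i with rfl | rfl | rfl | rfl | rfl <;> rcases hcover j with rfl | rfl | rfl | rfl | rfl <;>
      simp only [wp, wa, wb, wc, wd] at hij' <;>
      first | rfl | exact absurd hij' ‹_› | exact absurd hij'.symm ‹_›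

/-- Splitting a sum over `Fin 5` along five distinct letters. [folklore] -/
theorem sum_five_letters {M : Type*} [AddCommMonoid M] (A B k l m : Fin 5) (hAB : A ≠ B) (hAk : A ≠ k) (hAl : A ≠ l)
    (hAm : A ≠ m) (hBk : B ≠ k) (hBl : B ≠ l) (hBm : B ≠ m) (hkl : k ≠ l) (hkm : k ≠ m) (hlm : l ≠ m) (g : Fin 5 → M) :
    ∑ z : Fin 5, g z = g A + g B + g k + g l + g m := by
  have hc5 : ({A, B, k, l, m} : Finset (Fin 5)).card = 5 := by
    rw [Finset.card_insert_of_notMem, Finset.card_insert_of_notMem, Finset.card_insert_of_notMem, Finset.card_pair hlm]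
    · simp [hkl, hkm]
    · simp [hBk, hBl, hBm]
    · simp [hAB, hAk, hAl, hAm]
  have huniv : ({A, B, k, l, m} : Finset (Fin 5)) = Finset.univ := Finset.eq_univ_of_card _ (by rw [hc5]; simp)
  rw [← huniv, Finset.sum_insert (by simp [hAB, hAk, hAl, hAm]), Finset.sum_insert (by simp [hBk, hBl, hBm]),
    Finset.sum_insert (by simp [hkl, hkm]), Finset.sum_pair hlm]
  simp only [add_assoc]

/-- **The pattern cubic off the diagonal**: `Σ_{C,D,E} [A,B,C,D,E distinct] X_CX_DX_E = 6·x^{{A,B}ᶜ}` for `A ≠ B`. [folklore] -/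
theorem pattern_cubic (A B : Fin 5) (hAB : A ≠ B) :
    (∑ c : Fin 5, ∑ d : Fin 5, ∑ e : Fin 5,
        C (if (A ≠ B ∧ A ≠ c ∧ A ≠ d ∧ A ≠ e ∧ B ≠ c ∧ B ≠ d ∧ B ≠ e ∧ c ≠ d ∧ c ≠ e ∧ d ≠ e) then (1 : ℂ) else 0)
          * X c * X d * X e : MvPolynomial (Fin 5) ℂ)
      = 6 * monomial (Finsupp.equivFunOnFinite.symm (fun z : Fin 5 => if z = A ∨ z = B then (0 : ℕ) else 1)) 1 := by
  classical
  -- name the three other letters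
  have hR : ((Finset.univ.erase A).erase B).card = 3 := by
    rw [Finset.card_erase_of_mem (by simp [Ne.symm hAB]), Finset.card_erase_of_mem (Finset.mem_univ _)]; simp
  obtain ⟨k, l, m, hkl, hkm, hlm, hRe⟩ := Finset.card_eq_three.mp hR
  have memR : ∀ z : Fin 5, z ∈ (Finset.univ.erase A).erase B ↔ z ≠ B ∧ z ≠ A := fun z => by simp [Finset.mem_erase]
  have hk : k ≠ B ∧ k ≠ A := (memR k).mp (by rw [hRe]; simp)
  have hl : l ≠ B ∧ l ≠ A := (memR l).mp (by rw [hRe]; simp)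
  have hm : m ≠ B ∧ m ≠ A := (memR m).mp (by rw [hRe]; simp)
  have hcover : ∀ z : Fin 5, z = A ∨ z = B ∨ z = k ∨ z = l ∨ z = m := by
    intro z
    by_cases hzA : z = A
    · exact Or.inl hzA
    by_cases hzB : z = B
    · exact Or.inr (Or.inl hzB)
    have hz : z ∈ (Finset.univ.erase A).erase B := (memR z).mpr ⟨hzB, hzA⟩
    rw [hRe] at hz
    simp only [Finset.mem_insert, Finset.mem_singleton] at hz
    rcases hz with h | h | h
    · exact Or.inr (Or.inr (Or.inl h))
    · exact Or.inr (Or.inr (Or.inr (Or.inl h)))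
    · exact Or.inr (Or.inr (Or.inr (Or.inr h)))
  obtain ⟨hkB, hkA⟩ := hk
  obtain ⟨hlB, hlA⟩ := hl
  obtain ⟨hmB, hmA⟩ := hm
  have hAk := Ne.symm hkA; have hAl := Ne.symm hlA; have hAm := Ne.symm hmA
  have hBk := Ne.symm hkB; have hBl := Ne.symm hlB; have hBm := Ne.symm hmB
  have hlk := Ne.symm hkl; have hmk := Ne.symm hkm; have hml := Ne.symm hlm
  have s5 := sum_five_letters (M := MvPolynomial (Fin 5) ℂ) A B k l m hAB hAk hAl hAm hBk hBl hBm hkl hkm hlm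
  -- expand the three sums along the five letters and evaluate the indicator
  simp only [s5, ne_eq, not_true_eq_false, hAB, hAk, hAl, hAm, hBk, hBl, hBm, hkl, hkm, hlm, hlk, hmk, hml,
    not_false_eq_true, and_true, true_and, and_false, false_and, and_self, if_true, if_false, C_0, C_1,
    zero_mul, one_mul, add_zero, zero_add]
  -- the squarefree monomial is `X_k X_l X_m`
  have hmono : (monomial (Finsupp.equivFunOnFinite.symm (fun z : Fin 5 => if z = A ∨ z = B then (0 : ℕ) else 1)) 1
      : MvPolynomial (Fin 5) ℂ) = X k * X l * X m := by
    have hexp : Finsupp.equivFunOnFinite.symm (fun z : Fin 5 => if z = A ∨ z = B then (0 : ℕ) else 1)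
        = Finsupp.single k 1 + Finsupp.single l 1 + Finsupp.single m 1 := by
      ext z
      rw [compl_exponent_apply]
      simp only [Finsupp.add_apply, Finsupp.single_apply]
      rcases hcover z with rfl | rfl | rfl | rfl | rfl
      · simp [hkA, hlA, hmA]
      · simp [hkB, hlB, hmB]
      · simp [hkA, hkB, hlk, hmk]
      · simp [hlA, hlB, hkl, hml]
      · simp [hmA, hmB, hkm, hlm]
    rw [hexp, X, X, X, monomial_mul, monomial_mul]
    norm_num
  rw [hmono]
  ring

/-- **The pattern cubic on the diagonal** vanishes. [folklore] -/
theorem pattern_cubic_diag (A : Fin 5) :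
    (∑ c : Fin 5, ∑ d : Fin 5, ∑ e : Fin 5,
        C (if (A ≠ A ∧ A ≠ c ∧ A ≠ d ∧ A ≠ e ∧ A ≠ c ∧ A ≠ d ∧ A ≠ e ∧ c ≠ d ∧ c ≠ e ∧ d ≠ e) then (1 : ℂ) else 0)
          * X c * X d * X e : MvPolynomial (Fin 5) ℂ) = 0 := by
  simp

end LaplaceFiveStar

end Summit.ValiantsHypothesis.ValiantsHypothesis.Theorems.RigidityForcesSymmetryRankRigidMinimalRepr
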